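import Summits.Ventures.LatticeQCDFlow.Scaling.DominatedStarGapAndMixing
import Summits.Ventures.LatticeQCDFlow.Scaling.BooleanStarDisagreementDrift

/-!
HONEST FRAMING: exact (Metropolis-corrected) sampling algorithms for lattice gauge theory; figures
of merit are autocorrelation/cost numbers at stated couplings and volumes; no continuum-physics
claim.

# SectorExactAugmentation — TRANSPORT MAPS EXACT ON EVERY SECTOR OF A PARTITION `ℓ : S → L` OF A GENERAL STATE SPACE: THE ACCEPTANCE
# OF A HUB ENTRY IS `min{1, c_r(ℓ z_0)/c_r(ℓ z_l)}`, A FUNCTION OF THE TWO SECTOR LABELS ONLY, AND THE STALE-SET AUGMENTATION (ACCEPTED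
# SWAP ⇒ THE TWO TAGS ARE EXCHANGED, REJECTED SWAP ⇒ NOTHING, HOT REDRAW ⇒ THE HUB BECOMES FRESH) IS A TRANSITION MATRIX LUMPING ONTO
# THE SCHEME (lean-2 GEN-30, ours)

Venture-side (OURS).  Cell `lqcd-flow` (pub-lqcd), unit `pub-lqcd-lean-2-g30`, 2026-08-28.  Chapter Q (OPEN-MATH-chapterM item 1 for
SECTOR-EXACT maps on a general finite `S`), file 1.  THE MODEL: the scheme `P = t·GSw + (1−t)·Π_w^M` of chapters J–P on `Fin (K+1) → S`,
a PARTITION of `S` into sectors given by a label map `ℓ : S → L` (`L` finite — two topological sectors, or the `q` values of a topological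
charge), entry maps `φ_r` preserving the labels (`ℓ(φ_r u) = ℓ(u)`), and SECTOR-EXACT transport: `μ_{κ_r+1}(φ_r u) = c_r(ℓ u)·μ_0(u)` with
positive sector constants `c_r : L → ℝ` — the flow reproduces every cold law exactly WITHIN each sector and errs only on the sector
WEIGHTS (the topological-freezing picture: the shape inside a sector is right, the relative weights of the sectors are off by the map
quality).  Then the Metropolis acceptance of entry `r` is `min{1, c_r(ℓ z_0)/c_r(ℓ z_l)}` — a function of the two labels — so a rejected
swap carries no information about the values beyond their labels.  THE STALE SET `D` (levels still holding their time-`0` content): an accepted swap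
exchanges the memberships of `0` and `l = κ_r+1` (`σ_r`), a rejected swap changes nothing, the hot redraw erases `0` — this is the
augmentation `P̂` of `Scaling/DominatedStarAugmentation` with good-tag weight `γ_r = α_r` and bad-tag map `B_r = id` (chapter M had to
stale both ends on rejection; sector-exactness makes that unnecessary, file 3).

## What is proved

* §1 **`sectorExact_accept_eq`** — `α_r(z) = min{1, c_r(ℓ z_0)/c_r(ℓ z_l)}`; `sectorExact_accept_ge` (`α_r ≥ a` for
  `a ≤ min{1, c_r(b)/c_r(b')}`); `sectorExact_accept_labels` (`α_r` depends on the two labels only).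
* §2 `sectorAug_isRowStochastic`, **`sectorAug_lawAt_fst`** (from `δ_{(x,univ)}` the configuration marginal of `P̂ⁿ` is `δ_x Pⁿ`) —
  chapter M's lemmas at `γ = α`, `B = id`.
* (the stale potential and its contraction: `Scaling/SectorExactStaleSet`, file 1b.)

Reading (no numerics implied): sector-exactness is the hypothesis under which a rejected swap is uninformative beyond the labels — the
property chapter M's tags could not have for general maps.  NOT CLAIMED here: the stale-set decay (file 1b), freshness (files 2–3), the law
(files 4–5).  Literature grade (cell rule): OWN
(chapter M's augmentation specialised); nothing cited as a fact; no new bib keys.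
-/

noncomputable section

open Finset Function
open Literature.Probability.MarkovChains

namespace Summit.Ventures.LatticeQCDFlow.Scaling

variable {S : Type*} [Fintype S] [DecidableEq S] {K m : ℕ} {μ : Fin (K + 1) → S → ℝ} {M : Fin (K + 1) → S → S → ℝ}
  {w : Fin (K + 1) → ℝ} {t : ℝ}

section SectorExact
variable (κ : Fin m → Fin K) (φ : Fin m → Equiv.Perm S) {L : Type*} (ℓ : S → L)

/-! ## §1 The acceptance under sector-exact transport -/

omit [DecidableEq S] in
/-- **SECTOR-EXACT TRANSPORT MAKES THE ACCEPTANCE A FUNCTION OF THE TWO LABELS:** with `μ_l(φ_r u) = c_r(ℓ u)μ_0(u)` (`c_r > 0`) and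
`φ_r` preserving the labels: `α_r(z) = min{1, c_r(ℓ z_0)/c_r(ℓ z_l)}` (`μ > 0`). [ours] -/
theorem sectorExact_accept_eq (hμ : ∀ k x, 0 < μ k x) (hφℓ : ∀ r u, ℓ (φ r u) = ℓ u)
    {cL : Fin m → L → ℝ} (hcL : ∀ r b, 0 < cL r b) (hexact : ∀ r u, μ (κ r).succ (φ r u) = cL r (ℓ u) * μ 0 u)
    {α : Fin m → (Fin (K + 1) → S) → ℝ}
    (hα : ∀ r z, α r z = min 1 (tensorFun μ (edgeFlowSwap (φ r) 0 (κ r).succ z) / tensorFun μ z))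
    (r : Fin m) (z : Fin (K + 1) → S) :
    α r z = min 1 (cL r (ℓ (z 0)) / cL r (ℓ (z (κ r).succ))) := by
  have h := accept_mul_pair κ φ hμ hα r z
  have hpos : 0 < μ 0 (z 0) * μ (κ r).succ (z (κ r).succ) := mul_pos (hμ _ _) (hμ _ _)
  -- `μ_0(φ⁻¹ z_l) = μ_l(z_l)/c_r(ℓ z_l)` and `μ_l(φ z_0) = c_r(ℓ z_0)μ_0(z_0)`
  have h1 : μ (κ r).succ (φ r (z 0)) = cL r (ℓ (z 0)) * μ 0 (z 0) := hexact r (z 0)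
  have h2 : μ (κ r).succ (z (κ r).succ) = cL r (ℓ (z (κ r).succ)) * μ 0 ((φ r).symm (z (κ r).succ)) := by
    have h := hexact r ((φ r).symm (z (κ r).succ))
    rw [Equiv.apply_symm_apply] at h
    rw [h]
    congr 2
    have := hφℓ r ((φ r).symm (z (κ r).succ)); rw [Equiv.apply_symm_apply] at this; exact this.symm
  set cz0 := cL r (ℓ (z 0)) with hcz0
  set czl := cL r (ℓ (z (κ r).succ)) with hczl
  have hcz0pos : 0 < cz0 := hcL r _
  have hczlpos : 0 < czl := hcL r _
  have hswap : μ 0 ((φ r).symm (z (κ r).succ)) * μ (κ r).succ (φ r (z 0))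
      = (μ 0 (z 0) * μ (κ r).succ (z (κ r).succ)) * (cz0 / czl) := by
    rw [h1, show μ 0 ((φ r).symm (z (κ r).succ)) = μ (κ r).succ (z (κ r).succ) / czl by
      rw [h2]; field_simp]
    field_simp
  have key : min (μ 0 (z 0) * μ (κ r).succ (z (κ r).succ)) ((μ 0 (z 0) * μ (κ r).succ (z (κ r).succ)) * (cz0 / czl))
      = (μ 0 (z 0) * μ (κ r).succ (z (κ r).succ)) * min 1 (cz0 / czl) := by
    rw [mul_min_of_nonneg _ _ hpos.le, mul_one]
  rw [hswap, key] at h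
  exact mul_right_cancel₀ hpos.ne' (h.trans (mul_comm _ _))

omit [DecidableEq S] in
/-- **Acceptance floor:** `a ≤ min{1, c_r(b)/c_r(b')}` for every entry and pair of labels gives `a ≤ α_r(z)` for every `z`. [ours] -/
theorem sectorExact_accept_ge (hμ : ∀ k x, 0 < μ k x) (hφℓ : ∀ r u, ℓ (φ r u) = ℓ u)
    {cL : Fin m → L → ℝ} (hcL : ∀ r b, 0 < cL r b) (hexact : ∀ r u, μ (κ r).succ (φ r u) = cL r (ℓ u) * μ 0 u)
    {α : Fin m → (Fin (K + 1) → S) → ℝ}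
    (hα : ∀ r z, α r z = min 1 (tensorFun μ (edgeFlowSwap (φ r) 0 (κ r).succ z) / tensorFun μ z))
    {a : ℝ} (ha : ∀ r b b', a ≤ min 1 (cL r b / cL r b')) (r : Fin m) (z : Fin (K + 1) → S) :
    a ≤ α r z := by
  rw [sectorExact_accept_eq κ φ ℓ hμ hφℓ hcL hexact hα r z]
  exact ha r _ _

omit [DecidableEq S] in
/-- **The acceptance sees the labels only:** configurations with the same labels at `0` and `l` have the same `α_r`. [ours] -/
theorem sectorExact_accept_labels (hμ : ∀ k x, 0 < μ k x) (hφℓ : ∀ r u, ℓ (φ r u) = ℓ u)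
    {cL : Fin m → L → ℝ} (hcL : ∀ r b, 0 < cL r b) (hexact : ∀ r u, μ (κ r).succ (φ r u) = cL r (ℓ u) * μ 0 u)
    {α : Fin m → (Fin (K + 1) → S) → ℝ}
    (hα : ∀ r z, α r z = min 1 (tensorFun μ (edgeFlowSwap (φ r) 0 (κ r).succ z) / tensorFun μ z))
    (r : Fin m) {z z' : Fin (K + 1) → S} (h0 : ℓ (z 0) = ℓ (z' 0)) (hl : ℓ (z (κ r).succ) = ℓ (z' (κ r).succ)) :
    α r z = α r z' := by
  rw [sectorExact_accept_eq κ φ ℓ hμ hφℓ hcL hexact hα r z, sectorExact_accept_eq κ φ ℓ hμ hφℓ hcL hexact hα r z', h0, hl]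

/-! ## §2 The stale-set augmentation (chapter M's `P̂` at `γ = α`, `B = id`) -/

/-- The augmented chain is a transition matrix (`m ≥ 1`, `0 ≤ t ≤ 1`, `w` a probability vector, `M_k` row-stochastic, `μ > 0`). [ours] -/
theorem sectorAug_isRowStochastic (hm : 1 ≤ m) (ht0 : 0 ≤ t) (ht1 : t ≤ 1) (hw0 : ∀ k, 0 ≤ w k) (hw1 : ∑ k, w k = 1)
    (hM : ∀ k, IsRowStochastic (M k)) (hμ : ∀ k x, 0 < μ k x)
    {α : Fin m → (Fin (K + 1) → S) → ℝ}
    (hα : ∀ r z, α r z = min 1 (tensorFun μ (edgeFlowSwap (φ r) 0 (κ r).succ z) / tensorFun μ z))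
    {Ph : (Fin (K + 1) → S) × Finset (Fin (K + 1)) → (Fin (K + 1) → S) × Finset (Fin (K + 1)) → ℝ}
    (hPh : ∀ a b, Ph a b = ∑ r : Fin m, t / m *
        ((fun r a => α r a.1) r a * (if b.1 = edgeFlowSwap (φ r) 0 (κ r).succ a.1
            ∧ b.2 = a.2.image (Equiv.swap (0 : Fin (K + 1)) (κ r).succ) then (1 : ℝ) else 0)
          + (α r a.1 - (fun r a => α r a.1) r a) * (if b.1 = edgeFlowSwap (φ r) 0 (κ r).succ a.1
            ∧ b.2 = (fun (_ : Fin m) (D : Finset (Fin (K + 1))) => D) r a.2 then (1 : ℝ) else 0)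
          + (1 - α r a.1) * (if b.1 = a.1 ∧ b.2 = (fun (_ : Fin m) (D : Finset (Fin (K + 1))) => D) r a.2 then (1 : ℝ) else 0))
      + (1 - t) * ∑ k : Fin (K + 1), w k * (coordKernel M k a.1 b.1
          * (if b.2 = (if k = 0 then a.2.erase 0 else a.2) then (1 : ℝ) else 0))) :
    IsRowStochastic Ph :=
  dom_aug_isRowStochastic κ φ hm ht0 ht1 hw0 hw1 hM hμ hα (γ := fun r a => α r a.1)
    (fun r a => ⟨(accept_mem κ φ hμ hα r a.1).1, le_rfl⟩) (Bset := fun (_ : Fin m) (D : Finset (Fin (K + 1))) => D) hPh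

/-- **From `δ_{(x,univ)}` the configuration marginal of `P̂ⁿ` is `δ_x Pⁿ`.** [ours] -/
theorem sectorAug_lawAt_fst (hm : 1 ≤ m) (hμ : ∀ k x, 0 < μ k x)
    {α : Fin m → (Fin (K + 1) → S) → ℝ}
    (hα : ∀ r z, α r z = min 1 (tensorFun μ (edgeFlowSwap (φ r) 0 (κ r).succ z) / tensorFun μ z))
    {Ph : (Fin (K + 1) → S) × Finset (Fin (K + 1)) → (Fin (K + 1) → S) × Finset (Fin (K + 1)) → ℝ}
    (hPh : ∀ a b, Ph a b = ∑ r : Fin m, t / m *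
        ((fun r a => α r a.1) r a * (if b.1 = edgeFlowSwap (φ r) 0 (κ r).succ a.1
            ∧ b.2 = a.2.image (Equiv.swap (0 : Fin (K + 1)) (κ r).succ) then (1 : ℝ) else 0)
          + (α r a.1 - (fun r a => α r a.1) r a) * (if b.1 = edgeFlowSwap (φ r) 0 (κ r).succ a.1
            ∧ b.2 = (fun (_ : Fin m) (D : Finset (Fin (K + 1))) => D) r a.2 then (1 : ℝ) else 0)
          + (1 - α r a.1) * (if b.1 = a.1 ∧ b.2 = (fun (_ : Fin m) (D : Finset (Fin (K + 1))) => D) r a.2 then (1 : ℝ) else 0))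
      + (1 - t) * ∑ k : Fin (K + 1), w k * (coordKernel M k a.1 b.1
          * (if b.2 = (if k = 0 then a.2.erase 0 else a.2) then (1 : ℝ) else 0)))
    (x : Fin (K + 1) → S) (n : ℕ) (z : Fin (K + 1) → S) :
    ∑ D : Finset (Fin (K + 1)), lawAt Ph (Pi.single (x, (univ : Finset (Fin (K + 1)))) 1) n (z, D)
      = lawAt (fun y z : Fin (K + 1) → S =>
          t * ptGraphSwap μ (fun r : Fin m => (((0 : Fin (K + 1)), (κ r).succ) : Fin (K + 1) × Fin (K + 1))) φ y z
          + (1 - t) * prodKernel w M y z) (Pi.single x 1) n z :=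
  dom_lawAt_fst κ φ hm hμ hα (γ := fun r a => α r a.1) (Bset := fun (_ : Fin m) (D : Finset (Fin (K + 1))) => D) hPh x n z

end SectorExact

end Summit.Ventures.LatticeQCDFlow.Scaling

end
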